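import Literature.Topology.FourManifolds.LinkKhMovie
import Literature.Topology.FourManifolds.LinkKhUnknotOne
import HarnessLib

/-!
# Canonical generators along a movie of link Gauss diagrams (link tower, layer T7b)

Sequel of `LinkKhMovie` (T7a: `Step`, `Movie`, `Movie.map`, `degShift`, `IsFilteredLeeMap`,
`Movie.colour`, `Movie.Coherent`, `relabelMap`): the COMBINATORIAL form of Rasmussen's
Prop. 4.1 ⇒ Cor. 4.2 (Rasmussen (2010), §4) — Lee's canonical generators
`𝔰 = leeMonomial 0 (leeState hc t u)` of `LinkLeeStates` are tracked along a coherent movie of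
a checkerboard-coloured diagram — and the adapters turning linear maps of degree-zero Lee
chains `C⁰(ofGaussDiagram P.diagram) ⇄ C⁰(unknots 1)` with link-tower hypotheses into EXACTLY
the hypotheses of the assembly `eq_zero_of_isSmoothlySlice_of_canonical_unknotOne`
(`LinkKhUnknotOne`).

## Contents and conventions

* **Lee coordinates of the canonical family** (`§ Coordinates`). For a checkerboard colouring
  `c`, a flip `t` and the free-circle labellings `u : Fin free → Bool`, the canonical states
  `leeState hc t u` all live over the Seifert state with the SAME labels on the chord arcs, so
  `pairCount` between two of them only sees the free circles (`pairCount_leeLabel`) and Lee's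
  orthogonality `Mᵀ M = 2^{#circles}` restricted to the family reads
  `Σ_v 𝔰_w(𝔰-state v) · 𝔰_{w'}(𝔰-state v) = 2^free [w = w']` (`sum_leeMonomial_leeState_mul`).
  Hence the coordinate functionals `leeStateCoord hc t w` (`= [u' = w]` on `𝔰_{u'}`), and the
  family `u' ↦ leeMonomial 0 (leeState hc t u')` is linearly independent
  (`linearIndependent_leeMonomial_leeState`).
* **Prop. 4.1 step by step** (`Step.coeff`, `Step.map_leeMonomial_leeState`): each elementary
  map sends `𝔰_{t,u}` to `Σ_{u'} coeff(u, u') • 𝔰'_{t,u'}` over the canonical states of the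
  next frame for the TRANSPORTED colouring and the SAME flip `t`: a birth branches into the two
  labels of the newborn circle with `-½` (`𝐛 = true`) and `½` (`𝐚 = false`)
  (`birthMap_leeMonomial_leeState`), a death selects (`1`, `deathMap_leeMonomial_leeState`),
  a coherent saddle is diagonal with `leeSaddleCoeff ≠ 0` (`saddleMap_leeMonomial_leeState`,
  needs `hsad` at the Seifert state, part of `Coherent`), a relabelling is diagonal with the
  Koszul sign `relabelSign (seifertState) = ±1` (`relabelMap_leeMonomial_leeState`).
* **Along a movie** (`Movie.coeff`, matrix product of the step coefficients;
  `Movie.map_leeMonomial_leeState`): `m.map 0 𝔰_{t,u} = Σ_{u'} m.coeff c t u u' • 𝔰'_{t,u'}`,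
  and `m.coeff c t u u'` IS the `u'`-th Lee coordinate of the image (`Movie.leeStateCoord_map`),
  so `m.map 0 𝔰_{t,u} ≠ 0 ↔ ∃ u', m.coeff c t u u' ≠ 0`.
* **The global flip** `t ↦ !t` (`𝔰_o ↦ 𝔰_ō`):
  `m.coeff c (!t) u u' = m.flipSign · m.coeff c t u u'` with `flipSign = ±1` (product of `-1`
  over the merging saddles: `m(𝐛 ⊗ 𝐛) = -2𝐛` versus `m(𝐚 ⊗ 𝐚) = 2𝐚`), so `𝔰_ō` is tracked
  exactly like `𝔰_o`, onto the flipped states (`Movie.coeff_not`,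
  `Movie.map_leeMonomial_leeState_not`).
* **Nonvanishing needs connectivity, not only `χ`.** The sphere movie (birth then death) has
  map `0` (`Movie.map_birth_death` of T7a): branches of a birth cancel at a death. In this layer
  free circles are inert (no Reidemeister step), so the honest sufficient conditions are: no
  birth (`birthCount = 0`: the tracking is DIAGONAL, `𝔰_{t,u} ↦ w • 𝔰'_{t, push u}`, `w ≠ 0`,
  `Movie.map_leeMonomial_leeState_of_birthCount`) or no death (`deathCount = 0`: every branch
  survives, `coeff (u, u') = [pull u' = u] · w(u')`, `w ≠ 0`, `pull` surjective,
  `Movie.coeff_eq_of_deathCount`; the counts `birthCount`/`deathCount` and the label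
  transports `push`/`pull` are in T7a); in both cases `m.map 0 𝔰 ≠ 0`.
* **Adapters** (`§ Adapters`): `exists_canonical_of_ofGaussDiagram(_symm)` turn maps
  `C⁰(ofGaussDiagram G) → C⁰(unknots 1)` (boundaries ↦ boundaries, `qMin` non-decreasing,
  tracking the two link-tower canonical generators `𝔰_t`, `t : Bool`, with nonzero constants
  modulo boundaries onto an injective pair of enhanced states of `unknots 1`) and
  `C⁰(unknots 1) → C⁰(ofGaussDiagram G)` (cycles ↦ cycles, …) into maps `C⁰(G) ⇄ C⁰(unknots 1)`
  satisfying LITERALLY the hypotheses of `eq_zero_of_isSmoothlySlice_of_canonical_unknotOne`,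
  through `degStatesEquiv` / `LinearEquiv.funCongrLeft` (`khovanovD_comp_funCongrLeft`,
  `qMin_funCongrLeft`), `funCongrLeft_leeCoord_symm_single_leeState` (the knot tower's
  canonical generator is `2^{-#circles} • 𝔰_t`) and `GaussDiagram.noFreeEquivBool` (the
  canonical states of a knot diagram with Gauss parity are `leeState hpar t`, `t : Bool`);
  packaged for a regular projection `P` with `P.diagram.n ≠ 0` (Gauss parity from
  `RegularProjection.overPos_mod_two_ne_underPos_mod_two`) as `canonical_hypotheses_of_linkMaps`.
  The crossingless projections (`P.diagram.n = 0`, where `ofGaussDiagram P.diagram = unknots 0`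
  is useless) need no data: `P.diagram = GaussDiagram.empty` and the comparison equivalence of
  `LinkKhUnknotOne` does it (`canonical_hypotheses_of_n_eq_zero`). Together:
  `eq_zero_of_isSmoothlySlice_of_linkMaps` — the named fact `eq_zero_of_isSmoothlySlice`
  follows from link-tower data for the projections with a crossing.
  What a movie of THIS layer cannot supply: `Movie (ofGaussDiagram P.diagram) (unknots 1)` is
  empty for `P.diagram.n ≠ 0` (`Movie.n_eq`; `isEmpty_movie_ofGaussDiagram_unknots`) — the
  Reidemeister steps are the next layer; their maps will enter through `IsFilteredLeeMap.comp`
  and these adapters.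

## References

* J. Rasmussen, *Khovanov homology and the slice genus*, Invent. Math. 182 (2010) 419–447,
  §2.3 (canonical generators), §4.1–4.2, Prop. 4.1 (p. 9: chain-level tracking of `𝔰_o`),
  Cor. 4.2, §4.4. [cite: Rasmussen2010, §4]
* E. S. Lee, *An endomorphism of the Khovanov invariant*, Adv. Math. 197 (2005), §4.4
  (orthogonality of the basis `𝐚`, `𝐛`), Thm. 4.2. [cite: Lee2005, §4.4]
-/

open Function Set
open Literature.Topology.FourManifolds.GaussDiagram (pairSign sum_pairSign_mul_pairSign leeSign)

noncomputable section

namespace Literature.Topology.FourManifolds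

namespace LinkGaussDiagram

variable {L L' L'' : LinkGaussDiagram}

/-! ## Lee coordinates of the canonical family -/

section Coordinates

variable {c : Fin (2 * L.n) → Bool}

/-- Lee's canonical state `leeState hc t u` as a basis element of the degree-zero cochain group
(`homDegree_leeState`). [cite: Rasmussen2010, §2.3] -/
abbrev leeState₀ (hc : L.IsCheckerboard c) (t : Bool) (u : Fin L.free → Bool) : L.degStates 0 :=
  ⟨L.leeState hc t u, homDegree_leeState hc t u⟩

/-- Free circles are state circles on their own: `j ↦ circleOf σ (inr j)` is injective.
[folklore] -/
theorem circleOf_inr_injective (σ : L.State) :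
    Injective fun j : Fin L.free ↦ L.circleOf σ (.inr j) :=
  fun j j' h ↦ Sum.inr_injective ((L.circleOf_inr_eq_iff σ j (.inr j')).1 h).symm

/-- **`pairCount` between two Lee labellings only sees the free circles.** For the same
colouring `c` and flip `t`, the labellings `leeLabel c t v`, `leeLabel c t w` agree on every
chord arc, so the circles labelled `(λ = 1, ℓ = 𝐛)` are exactly the free circles `j` with
`v j = 1 (false)`, `w j = 𝐛 (true)` — in ANY state `σ`. [cite: Lee2005, §4.4] -/
theorem pairCount_leeLabel (σ : L.State) (c : Fin (2 * L.n) → Bool) (t : Bool)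
    (v w : Fin L.free → Bool) :
    L.pairCount σ (L.leeLabel c t v) (L.leeLabel c t w) =
      (Finset.univ.filter fun j ↦ (!v j && w j) = true).card := by
  classical
  unfold pairCount
  rw [← Finset.card_image_of_injective _ (L.circleOf_inr_injective σ)]
  congr 1
  ext C
  simp only [Finset.mem_filter, Finset.mem_univ, true_and, Finset.mem_image]
  constructor
  · rintro ⟨a, rfl, ha⟩
    rcases a with q | j
    · have h : (!L.leeLabel c t v (.inl q) && L.leeLabel c t w (.inl q)) = false := by
        show (!(bif c q then t else !t) && (bif c q then t else !t)) = false
        cases c q <;> cases t <;> rfl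
      rw [h] at ha
      exact absurd ha Bool.false_ne_true
    · exact ⟨j, ha, rfl⟩
  · rintro ⟨j, hj, rfl⟩
    exact ⟨.inr j, rfl, hj⟩

/-- **The sign between two canonical labellings is a product over the free circles** of the
one-circle signs `pairSign (v j) (w j)` (`-1` for `(1, 𝐛)`, else `1`). [cite: Lee2005, §4.4] -/
theorem neg_one_pow_pairCount_leeLabel (σ : L.State) (c : Fin (2 * L.n) → Bool) (t : Bool)
    (v w : Fin L.free → Bool) :
    (-1 : ℚ) ^ L.pairCount σ (L.leeLabel c t v) (L.leeLabel c t w) = ∏ j, pairSign (v j) (w j) := by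
  rw [pairCount_leeLabel]
  unfold GaussDiagram.pairSign
  rw [Finset.prod_ite, Finset.prod_const_one, mul_one, Finset.prod_const]

/-- The Lee monomial of `leeState hc t w` evaluated at the canonical state `leeState hc t v` is
the product of the one-circle signs over the free circles. [cite: Lee2005, §4.4] -/
theorem leeMonomial_leeState_leeState₀ (hc : L.IsCheckerboard c) (t : Bool)
    (w v : Fin L.free → Bool) :
    L.leeMonomial 0 (L.leeState hc t w) (L.leeState₀ hc t v) = ∏ j, pairSign (v j) (w j) := by
  show (if L.seifertState = L.seifertState then
    (-1 : ℚ) ^ L.pairCount L.seifertState (L.leeLabel c t v) (L.leeLabel c t w) else 0) = _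
  rw [if_pos rfl]
  exact neg_one_pow_pairCount_leeLabel _ _ _ _ _

/-- **Lee's orthogonality on the canonical family**: `Σ_v 𝔰_w(v) · 𝔰_{w'}(v) = 2^free [w = w']`,
the sum over the canonical states `v` (the Kronecker power over the free circles of
`[[1, -1], [1, 1]]ᵀ [[1, -1], [1, 1]] = 2 · 1`, `sum_pairSign_mul_pairSign`). Lee (2005), §4.4.2.
[cite: Lee2005, §4.4] -/
theorem sum_leeMonomial_leeState_mul (hc : L.IsCheckerboard c) (t : Bool)
    (w w' : Fin L.free → Bool) :
    ∑ v : Fin L.free → Bool, L.leeMonomial 0 (L.leeState hc t w) (L.leeState₀ hc t v) *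
        L.leeMonomial 0 (L.leeState hc t w') (L.leeState₀ hc t v) =
      if w = w' then (2 : ℚ) ^ L.free else 0 := by
  classical
  simp_rw [leeMonomial_leeState_leeState₀, ← Finset.prod_mul_distrib]
  rw [← Fintype.prod_sum fun j x ↦ pairSign x (w j) * pairSign x (w' j)]
  simp only [sum_pairSign_mul_pairSign]
  by_cases hw : w = w'
  · subst hw
    simp
  · rw [if_neg hw]
    obtain ⟨j, hj⟩ := Function.ne_iff.1 hw
    exact Finset.prod_eq_zero (Finset.mem_univ j) (if_neg hj)

variable (L) in
/-- **The Lee coordinate at the canonical state `w`**: the functional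
`x ↦ 2^{-free} Σ_v 𝔰_w(v) · x(v)` on degree-zero chains (pairing with `𝔰_w` over the canonical
states), normalised so that it is the indicator of `w` on the canonical family.
[cite: Lee2005, §4.4] -/
def leeStateCoord (hc : L.IsCheckerboard c) (t : Bool) (w : Fin L.free → Bool) :
    (L.degStates 0 → ℚ) →ₗ[ℚ] ℚ where
  toFun x := ((2 : ℚ) ^ L.free)⁻¹ *
    ∑ v, L.leeMonomial 0 (L.leeState hc t w) (L.leeState₀ hc t v) * x (L.leeState₀ hc t v)
  map_add' x y := by
    simp only [Pi.add_apply, mul_add, Finset.sum_add_distrib]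
  map_smul' r x := by
    simp only [Pi.smul_apply, smul_eq_mul, RingHom.id_apply, Finset.mul_sum]
    exact Finset.sum_congr rfl fun v _ ↦ by ring

/-- **The Lee coordinates are the indicators on the canonical family**:
`leeStateCoord w (𝔰_{u'}) = [u' = w]`. [cite: Lee2005, §4.4] -/
theorem leeStateCoord_leeMonomial_leeState (hc : L.IsCheckerboard c) (t : Bool)
    (w u' : Fin L.free → Bool) :
    L.leeStateCoord hc t w (L.leeMonomial 0 (L.leeState hc t u')) = if u' = w then 1 else 0 := by
  show ((2 : ℚ) ^ L.free)⁻¹ * _ = _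
  rw [sum_leeMonomial_leeState_mul hc t w u']
  by_cases h : u' = w
  · rw [if_pos h, if_pos h.symm, inv_mul_cancel₀ (pow_ne_zero _ two_ne_zero)]
  · rw [if_neg h, if_neg (Ne.symm h), mul_zero]

/-- The Lee coordinate at `w` of a combination of canonical generators is its `w`-th
coefficient. [cite: Lee2005, §4.4] -/
theorem leeStateCoord_sum_smul (hc : L.IsCheckerboard c) (t : Bool)
    (a : (Fin L.free → Bool) → ℚ) (w : Fin L.free → Bool) :
    L.leeStateCoord hc t w (∑ u', a u' • L.leeMonomial 0 (L.leeState hc t u')) = a w := by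
  classical
  rw [map_sum]
  simp_rw [map_smul, leeStateCoord_leeMonomial_leeState, smul_eq_mul, mul_ite, mul_one, mul_zero]
  rw [Finset.sum_ite_eq' Finset.univ w, if_pos (Finset.mem_univ _)]

/-- **The canonical generators with the same flip are linearly independent**
(`u' ↦ leeMonomial 0 (leeState hc t u')`): the Lee coordinates separate them. Lee (2005),
Thm. 4.2 (for the unlink part); Rasmussen (2010), §2.3. [cite: Lee2005, §4.4] -/
theorem linearIndependent_leeMonomial_leeState (hc : L.IsCheckerboard c) (t : Bool) :
    LinearIndependent ℚ fun u' : Fin L.free → Bool ↦ L.leeMonomial 0 (L.leeState hc t u') := by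
  rw [Fintype.linearIndependent_iff]
  intro a ha w
  have h := congrArg (L.leeStateCoord hc t w) ha
  rwa [leeStateCoord_sum_smul, map_zero] at h

/-- Collapsing a diagonal sum of scalar multiples. [folklore] -/
theorem sum_ite_eq_smul {ι M : Type*} [Fintype ι] [DecidableEq ι] [AddCommMonoid M] [Module ℚ M]
    (a : ι) (r : ℚ) (f : ι → M) : ∑ x, (if x = a then r else 0) • f x = r • f a := by
  simp_rw [ite_smul, zero_smul]
  rw [Finset.sum_ite_eq' Finset.univ a, if_pos (Finset.mem_univ _)]

end Coordinates

/-! ## Prop. 4.1 step by step: the coefficients of an elementary move -/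

/-- **The coefficients of Prop. 4.1 for an elementary move**: the coefficient of the canonical
generator `𝔰'_{t,u'}` of the next frame in the image of `𝔰_{t,u}` — a birth branches into the
two labels of the newborn (last) free circle with `-½` for `𝐛 = true`, `½` for `𝐚 = false`
(`u' = Fin.snoc u b`); a death keeps `Fin.init u` with `1`; a saddle keeps `u` with
`leeSaddleCoeff`; a relabelling renumbers `u ↦ u ∘ φ⁻¹` with the Koszul sign of the Seifert
state. Rasmussen (2010), Prop. 4.1. [cite: Rasmussen2010, §4 Prop. 4.1] -/
def Step.coeff : {L L' : LinkGaussDiagram} → Step L L' → (Fin (2 * L.n) → Bool) → Bool →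
    (Fin L.free → Bool) → (Fin L'.free → Bool) → ℚ
  | _, _, .birth L, _, _, u, u' =>
      if Fin.init u' = u then (if u' (Fin.last L.free) = true then -(1 / 2) else 1 / 2) else 0
  | _, _, .death _, _, _, u, u' => if u' = Fin.init u then 1 else 0
  | _, _, .saddle L p q _, c, t, u, u' => if u' = u then L.leeSaddleCoeff p q c t else 0
  | _, _, .relabel L τ κ φ, _, _, u, u' =>
      if u' = u ∘ ⇑φ.symm then L.relabelSign τ κ φ L.seifertState else 0

/-- **Prop. 4.1 for one coherent step**: the map of the step sends the canonical generator
`𝔰_{t,u} = leeMonomial 0 (leeState hc t u)` to `Σ_{u'} coeff(u, u') • 𝔰'_{t,u'}`, the canonical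
generators of the next frame for the transported colouring and the same flip
(`birthMap_leeMonomial_leeState`, `deathMap_leeMonomial_leeState`,
`saddleMap_leeMonomial_leeState`, `relabelMap_leeMonomial_leeState`). Rasmussen (2010), Prop. 4.1.
[cite: Rasmussen2010, §4 Prop. 4.1] -/
theorem Step.map_leeMonomial_leeState : ∀ {L L' : LinkGaussDiagram} (s : Step L L')
    {c : Fin (2 * L.n) → Bool} (hc : L.IsCheckerboard c) (hs : s.Coherent c) (t : Bool)
    (u : Fin L.free → Bool),
    s.map 0 (L.leeMonomial 0 (L.leeState hc t u)) =
      ∑ u', s.coeff c t u u' • L'.leeMonomial 0 (L'.leeState (hc.step s hs) t u')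
  | _, _, .birth L, c, hc, hs, t, u => by
    classical
    show L.birthMap ℚ 0 (L.leeMonomial 0 (L.leeState hc t u)) =
      ∑ u' : Fin (L.free + 1) → Bool, Step.coeff (Step.birth L) c t u u' •
        L.birth.leeMonomial 0 (L.birth.leeState hc.birth t u')
    rw [birthMap_leeMonomial_leeState hc t u]
    have hne : (Fin.snoc u true : Fin (L.free + 1) → Bool) ≠ Fin.snoc u false := fun h ↦ by
      simpa using congrFun h (Fin.last L.free)
    have e1 : Step.coeff (Step.birth L) c t u (Fin.snoc u true : Fin (L.free + 1) → Bool) =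
        -(1 / 2) := by
      simp [Step.coeff]
    have e2 : Step.coeff (Step.birth L) c t u (Fin.snoc u false : Fin (L.free + 1) → Bool) =
        1 / 2 := by
      simp [Step.coeff]
    symm
    rw [Fintype.sum_eq_add (Fin.snoc u true : Fin (L.free + 1) → Bool) (Fin.snoc u false) hne,
      e1, e2]
    · rfl
    rintro u' ⟨h₁, h₂⟩
    have h0 : Step.coeff (Step.birth L) c t u u' = 0 := by
      simp only [Step.coeff]
      rw [if_neg]
      intro hu
      have hu' : u' = Fin.snoc u (u' (Fin.last L.free)) := by rw [← hu, Fin.snoc_init_self]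
      cases hb : u' (Fin.last L.free)
      · exact h₂ (by rw [hu', hb])
      · exact h₁ (by rw [hu', hb])
    rw [h0, zero_smul]
  | _, _, .death L, c, hc, _, t, u => by
    classical
    rw [Step.map, deathMap_leeMonomial_leeState ((L.isCheckerboard_birth_iff c).1 hc) t u]
    symm
    simp only [Step.coeff]
    exact sum_ite_eq_smul (Fin.init u) 1 _ |>.trans (one_smul _ _)
  | _, _, .saddle L p q _, c, hc, hs, t, u => by
    classical
    rw [Step.map, saddleMap_leeMonomial_leeState hc hs.1 (hs.2 _) t u]
    symm
    simp only [Step.coeff]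
    exact sum_ite_eq_smul u _ _
  | _, _, .relabel L τ κ φ, c, hc, _, t, u => by
    classical
    rw [Step.map, LinearEquiv.coe_coe, relabelMap_leeMonomial_leeState]
    symm
    simp only [Step.coeff]
    exact sum_ite_eq_smul (u ∘ ⇑φ.symm) _ _

/-! ## Along a movie: the coefficient matrix and the tracking formula -/

/-- **The coefficients of Prop. 4.1 along a movie**: the matrix product of the step
coefficients (colourings transported along the way), i.e. the coefficient of `𝔰'_{t,u'}` in
`m.map 0 𝔰_{t,u}` (`Movie.map_leeMonomial_leeState`, `Movie.leeStateCoord_map`).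
[cite: Rasmussen2010, §4 Prop. 4.1] -/
def Movie.coeff : {L L' : LinkGaussDiagram} → Movie L L' → (Fin (2 * L.n) → Bool) → Bool →
    (Fin L.free → Bool) → (Fin L'.free → Bool) → ℚ
  | _, _, .nil _, _, _, u, u' => if u' = u then 1 else 0
  | _, _, .cons s m, c, t, u, u' => ∑ v, s.coeff c t u v * m.coeff (s.colour c) t v u'

/-- **Prop. 4.1 along a coherent movie (the claim in Rasmussen's proof).** For a
checkerboard-coloured diagram and a coherent movie `m`, the composite map sends the canonical
generator `𝔰_{t,u}` to the combination `Σ_{u'} m.coeff c t u u' • 𝔰'_{t,u'}` of the canonical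
generators of the final frame, for the transported colouring `m.colour c` and the SAME flip
`t`. Rasmussen (2010), proof of Prop. 4.1 ("`φ(𝔰_o) = Σ a_I 𝔰_{o_I}`").
[cite: Rasmussen2010, §4 Prop. 4.1] -/
theorem Movie.map_leeMonomial_leeState : ∀ {L L' : LinkGaussDiagram} (m : Movie L L')
    {c : Fin (2 * L.n) → Bool} (hc : L.IsCheckerboard c) (hm : m.Coherent c) (t : Bool)
    (u : Fin L.free → Bool),
    m.map 0 (L.leeMonomial 0 (L.leeState hc t u)) =
      ∑ u', m.coeff c t u u' • L'.leeMonomial 0 (L'.leeState (hc.movie m hm) t u')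
  | _, _, .nil L, c, hc, _, t, u => by
    classical
    rw [Movie.map_nil, LinearMap.id_apply]
    symm
    simp only [Movie.coeff]
    exact sum_ite_eq_smul u 1 _ |>.trans (one_smul _ _)
  | _, _, .cons s m, c, hc, hm, t, u => by
    rw [Movie.map_cons, LinearMap.comp_apply, s.map_leeMonomial_leeState hc hm.1 t u, map_sum]
    simp_rw [map_smul, Movie.map_leeMonomial_leeState m (hc.step s hm.1) hm.2 t, Finset.smul_sum,
      smul_smul]
    rw [Finset.sum_comm]
    simp_rw [← Finset.sum_smul]
    rfl

/-- **The movie coefficient is the Lee coordinate of the image**: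
`leeStateCoord u' (m.map 0 𝔰_{t,u}) = m.coeff c t u u'`. [cite: Rasmussen2010, §4 Prop. 4.1] -/
theorem Movie.leeStateCoord_map (m : Movie L L') {c : Fin (2 * L.n) → Bool}
    (hc : L.IsCheckerboard c) (hm : m.Coherent c) (t : Bool) (u : Fin L.free → Bool)
    (u' : Fin L'.free → Bool) :
    L'.leeStateCoord (hc.movie m hm) t u' (m.map 0 (L.leeMonomial 0 (L.leeState hc t u))) =
      m.coeff c t u u' := by
  rw [m.map_leeMonomial_leeState hc hm t u, leeStateCoord_sum_smul]

/-- **The image of a canonical generator is nonzero iff some coefficient is.**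
[cite: Rasmussen2010, §4 Prop. 4.1] -/
theorem Movie.map_leeMonomial_leeState_ne_zero_iff (m : Movie L L') {c : Fin (2 * L.n) → Bool}
    (hc : L.IsCheckerboard c) (hm : m.Coherent c) (t : Bool) (u : Fin L.free → Bool) :
    m.map 0 (L.leeMonomial 0 (L.leeState hc t u)) ≠ 0 ↔ ∃ u', m.coeff c t u u' ≠ 0 := by
  constructor
  · intro h
    by_contra hall
    apply h
    rw [m.map_leeMonomial_leeState hc hm t u]
    exact Finset.sum_eq_zero fun u' _ ↦ by
      rw [show m.coeff c t u u' = 0 from not_not.1 fun hne ↦ hall ⟨u', hne⟩, zero_smul]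
  · rintro ⟨u', hu'⟩ h
    apply hu'
    rw [← m.leeStateCoord_map hc hm t u u', h, map_zero]

/-! ## The global flip `t ↦ !t` -/

/-- The saddle constant changes sign with the flip at a merge and not at a split:
`leeSaddleCoeff c (!t) = ∓ leeSaddleCoeff c t` (`m(𝐛 ⊗ 𝐛) = -2𝐛`, `m(𝐚 ⊗ 𝐚) = 2𝐚`, `Δ`
symmetric). [cite: Rasmussen2010, §4 Prop. 4.1] -/
theorem leeSaddleCoeff_not (L : LinkGaussDiagram) (p q : Fin (2 * L.n)) (c : Fin (2 * L.n) → Bool)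
    (t : Bool) : L.leeSaddleCoeff p q c (!t) =
      (if L.IsSaddleMerge p q L.seifertState then -1 else 1) * L.leeSaddleCoeff p q c t := by
  unfold leeSaddleCoeff
  split_ifs
  · unfold GaussDiagram.leeSign
    cases c p <;> cases t <;> norm_num
  · rw [one_mul]

/-- **The sign of the global flip along a step**: `-1` for a saddle merging two Seifert
circles, `1` otherwise. [cite: Rasmussen2010, §4 Prop. 4.1] -/
def Step.flipSign : {L L' : LinkGaussDiagram} → Step L L' → ℚ
  | _, _, .saddle L p q _ => if L.IsSaddleMerge p q L.seifertState then -1 else 1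
  | _, _, .birth _ => 1
  | _, _, .death _ => 1
  | _, _, .relabel _ _ _ _ => 1

/-- The sign of the global flip along a movie (product over the steps).
[cite: Rasmussen2010, §4 Prop. 4.1] -/
def Movie.flipSign : {L L' : LinkGaussDiagram} → Movie L L' → ℚ
  | _, _, .nil _ => 1
  | _, _, .cons s m => s.flipSign * m.flipSign

/-- The flip sign of a step squares to `1`. [folklore] -/
theorem Step.flipSign_mul_self : ∀ {L L' : LinkGaussDiagram} (s : Step L L'),
    s.flipSign * s.flipSign = 1
  | _, _, .saddle _ _ _ _ => by simp only [Step.flipSign]; split_ifs <;> norm_num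
  | _, _, .birth _ => one_mul 1
  | _, _, .death _ => one_mul 1
  | _, _, .relabel _ _ _ _ => one_mul 1

/-- The flip sign of a movie squares to `1`. [folklore] -/
theorem Movie.flipSign_mul_self : ∀ {L L' : LinkGaussDiagram} (m : Movie L L'),
    m.flipSign * m.flipSign = 1
  | _, _, .nil _ => one_mul 1
  | _, _, .cons s m => by
    rw [Movie.flipSign, mul_mul_mul_comm, s.flipSign_mul_self, m.flipSign_mul_self, one_mul]

/-- **Flipping `t` multiplies the step coefficients by the flip sign** (only the saddle
constant sees `t`). [cite: Rasmussen2010, §4 Prop. 4.1] -/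
theorem Step.coeff_not : ∀ {L L' : LinkGaussDiagram} (s : Step L L') (c : Fin (2 * L.n) → Bool)
    (t : Bool) (u : Fin L.free → Bool) (u' : Fin L'.free → Bool),
    s.coeff c (!t) u u' = s.flipSign * s.coeff c t u u'
  | _, _, .birth _, _, _, _, _ => by simp only [Step.coeff, Step.flipSign, one_mul]
  | _, _, .death _, _, _, _, _ => by simp only [Step.coeff, Step.flipSign, one_mul]
  | _, _, .saddle L p q _, c, t, u, u' => by
    simp only [Step.coeff, Step.flipSign]
    by_cases hu : u' = u
    · rw [if_pos hu, if_pos hu, leeSaddleCoeff_not]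
    · rw [if_neg hu, if_neg hu, mul_zero]
  | _, _, .relabel _ _ _ _, _, _, _, _ => by simp only [Step.coeff, Step.flipSign, one_mul]

/-- **Flipping `t` multiplies the movie coefficients by the flip sign**: the canonical
generator `𝔰_ō = 𝔰_{!t,u}` is tracked along the movie with the same branching as `𝔰_o`, up to
the global unit `flipSign = ±1`. Rasmussen (2010), Prop. 4.1 / Cor. 4.2 (`𝔰_o`, `𝔰_ō` go to
`k₁ 𝔰_{o'}`, `k₂ 𝔰_{ō'}`). [cite: Rasmussen2010, Cor. 4.2] -/
theorem Movie.coeff_not : ∀ {L L' : LinkGaussDiagram} (m : Movie L L') (c : Fin (2 * L.n) → Bool)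
    (t : Bool) (u : Fin L.free → Bool) (u' : Fin L'.free → Bool),
    m.coeff c (!t) u u' = m.flipSign * m.coeff c t u u'
  | _, _, .nil _, _, _, _, _ => by simp only [Movie.coeff, Movie.flipSign, one_mul]
  | _, _, .cons s m, c, t, u, u' => by
    simp only [Movie.coeff, Movie.flipSign, Finset.mul_sum]
    refine Finset.sum_congr rfl fun v _ ↦ ?_
    rw [s.coeff_not, m.coeff_not]
    ring

/-- A movie coefficient vanishes for `!t` iff it vanishes for `t`.
[cite: Rasmussen2010, Cor. 4.2] -/
theorem Movie.coeff_not_ne_zero_iff (m : Movie L L') (c : Fin (2 * L.n) → Bool) (t : Bool)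
    (u : Fin L.free → Bool) (u' : Fin L'.free → Bool) :
    m.coeff c (!t) u u' ≠ 0 ↔ m.coeff c t u u' ≠ 0 := by
  rw [m.coeff_not, mul_ne_zero_iff, and_iff_right]
  exact left_ne_zero_of_mul_eq_one m.flipSign_mul_self

/-- **The flipped generator lands on the flipped states**:
`m.map 0 𝔰_{!t,u} = flipSign • Σ_{u'} m.coeff c t u u' • 𝔰'_{!t,u'}`.
[cite: Rasmussen2010, Cor. 4.2] -/
theorem Movie.map_leeMonomial_leeState_not (m : Movie L L') {c : Fin (2 * L.n) → Bool}
    (hc : L.IsCheckerboard c) (hm : m.Coherent c) (t : Bool) (u : Fin L.free → Bool) :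
    m.map 0 (L.leeMonomial 0 (L.leeState hc (!t) u)) =
      m.flipSign •
        ∑ u', m.coeff c t u u' • L'.leeMonomial 0 (L'.leeState (hc.movie m hm) (!t) u') := by
  rw [m.map_leeMonomial_leeState hc hm (!t) u, Finset.smul_sum]
  exact Finset.sum_congr rfl fun u' _ ↦ by rw [m.coeff_not, smul_smul]

/-! ## Nonvanishing: movies without births, movies without deaths -/

/-- **The weight of a step at a final labelling**: the nonzero constant of Prop. 4.1 — `∓½`
according to the label of the newborn circle for a birth, `1` for a death, `leeSaddleCoeff`
for a saddle, the Koszul sign for a relabelling. [cite: Rasmussen2010, §4 Prop. 4.1] -/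
def Step.weight : {L L' : LinkGaussDiagram} → Step L L' → (Fin (2 * L.n) → Bool) → Bool →
    (Fin L'.free → Bool) → ℚ
  | _, _, .birth L, _, _, u' => if u' (Fin.last L.free) = true then -(1 / 2) else 1 / 2
  | _, _, .death _, _, _, _ => 1
  | _, _, .saddle L p q _, c, t, _ => L.leeSaddleCoeff p q c t
  | _, _, .relabel L τ κ φ, _, _, _ => L.relabelSign τ κ φ L.seifertState

/-- **The weights are nonzero** (`birth_coeff_ne_zero`, `leeSaddleCoeff_ne_zero`,
`relabelSign_ne_zero`). [cite: Rasmussen2010, §4 Prop. 4.1] -/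
theorem Step.weight_ne_zero : ∀ {L L' : LinkGaussDiagram} (s : Step L L')
    (c : Fin (2 * L.n) → Bool) (t : Bool) (u' : Fin L'.free → Bool), s.weight c t u' ≠ 0
  | _, _, .birth _, _, _, _ => by simp only [Step.weight]; split_ifs <;> norm_num
  | _, _, .death _, _, _, _ => one_ne_zero
  | _, _, .saddle L p q _, c, t, _ => L.leeSaddleCoeff_ne_zero c t
  | _, _, .relabel L τ κ φ, _, _, _ => L.relabelSign_ne_zero τ κ φ _

/-- The forward weight of a movie (product of the step weights along the pushed labels).
[cite: Rasmussen2010, §4 Prop. 4.1] -/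
def Movie.weightF : {L L' : LinkGaussDiagram} → Movie L L' → (Fin (2 * L.n) → Bool) → Bool →
    (Fin L.free → Bool) → ℚ
  | _, _, .nil _, _, _, _ => 1
  | _, _, .cons s m, c, t, u => s.weight c t (s.push u) * m.weightF (s.colour c) t (s.push u)

/-- The backward weight of a movie (product of the step weights along the pulled labels).
[cite: Rasmussen2010, §4 Prop. 4.1] -/
def Movie.weightB : {L L' : LinkGaussDiagram} → Movie L L' → (Fin (2 * L.n) → Bool) → Bool →
    (Fin L'.free → Bool) → ℚ
  | _, _, .nil _, _, _, _ => 1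
  | _, _, .cons s m, c, t, u' => s.weight c t (m.pull u') * m.weightB (s.colour c) t u'

/-- The forward weight is nonzero. [cite: Rasmussen2010, §4 Prop. 4.1] -/
theorem Movie.weightF_ne_zero : ∀ {L L' : LinkGaussDiagram} (m : Movie L L')
    (c : Fin (2 * L.n) → Bool) (t : Bool) (u : Fin L.free → Bool), m.weightF c t u ≠ 0
  | _, _, .nil _, _, _, _ => one_ne_zero
  | _, _, .cons s m, c, t, _ => mul_ne_zero (s.weight_ne_zero c t _) (m.weightF_ne_zero _ t _)

/-- The backward weight is nonzero. [cite: Rasmussen2010, §4 Prop. 4.1] -/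
theorem Movie.weightB_ne_zero : ∀ {L L' : LinkGaussDiagram} (m : Movie L L')
    (c : Fin (2 * L.n) → Bool) (t : Bool) (u' : Fin L'.free → Bool), m.weightB c t u' ≠ 0
  | _, _, .nil _, _, _, _ => one_ne_zero
  | _, _, .cons s m, c, t, _ => mul_ne_zero (s.weight_ne_zero c t _) (m.weightB_ne_zero _ t _)

/-- A step without birth is diagonal: `coeff (u, u') = [u' = push u] · weight`. [folklore] -/
theorem Step.coeff_eq_of_birthCount : ∀ {L L' : LinkGaussDiagram} (s : Step L L'),
    s.birthCount = 0 → ∀ (c : Fin (2 * L.n) → Bool) (t : Bool) (u : Fin L.free → Bool)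
      (u' : Fin L'.free → Bool), s.coeff c t u u' = if u' = s.push u then s.weight c t u' else 0
  | _, _, .birth _, h, _, _, _, _ => absurd h one_ne_zero
  | _, _, .death _, _, _, _, _, _ => rfl
  | _, _, .saddle _ _ _ _, _, _, _, _, _ => rfl
  | _, _, .relabel _ _ _ _, _, _, _, _, _ => rfl

/-- A step without death keeps every branch: `coeff (u, u') = [pull u' = u] · weight u'`.
[folklore] -/
theorem Step.coeff_eq_of_deathCount : ∀ {L L' : LinkGaussDiagram} (s : Step L L'),
    s.deathCount = 0 → ∀ (c : Fin (2 * L.n) → Bool) (t : Bool) (u : Fin L.free → Bool)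
      (u' : Fin L'.free → Bool), s.coeff c t u u' = if s.pull u' = u then s.weight c t u' else 0
  | _, _, .birth _, _, _, _, _, _ => rfl
  | _, _, .death _, h, _, _, _, _ => absurd h one_ne_zero
  | _, _, .saddle _ _ _ _, _, _, _, _, _ => rfl
  | _, _, .relabel _ _ _ φ, _, _, _, u, u' => by
    simp only [Step.coeff, Step.pull, Step.weight]
    have h : u' = u ∘ ⇑φ.symm ↔ u' ∘ ⇑φ = u := by
      constructor
      · rintro rfl; ext j; simp
      · rintro rfl; ext j; simp
    simp only [h]

/-- **Movies without births track diagonally**: `coeff (u, u') = [u' = push u] · weightF u`.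
[cite: Rasmussen2010, §4 Prop. 4.1] -/
theorem Movie.coeff_eq_of_birthCount : ∀ {L L' : LinkGaussDiagram} (m : Movie L L'),
    m.birthCount = 0 → ∀ (c : Fin (2 * L.n) → Bool) (t : Bool) (u : Fin L.free → Bool)
      (u' : Fin L'.free → Bool), m.coeff c t u u' = if u' = m.push u then m.weightF c t u else 0
  | _, _, .nil _, _, _, _, _, _ => by simp only [Movie.coeff, Movie.push, Movie.weightF]
  | _, _, .cons s m, h, c, t, u, u' => by
    classical
    have hs : s.birthCount = 0 := by unfold Movie.birthCount at h; omega
    have hm : m.birthCount = 0 := by unfold Movie.birthCount at h; omega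
    simp only [Movie.coeff, Movie.push, Movie.weightF, s.coeff_eq_of_birthCount hs,
      m.coeff_eq_of_birthCount hm, ite_mul, zero_mul]
    rw [Finset.sum_ite_eq' Finset.univ (s.push u), if_pos (Finset.mem_univ _)]
    split_ifs <;> ring

/-- **Movies without deaths keep every branch**: `coeff (u, u') = [pull u' = u] · weightB u'`.
[cite: Rasmussen2010, §4 Prop. 4.1] -/
theorem Movie.coeff_eq_of_deathCount : ∀ {L L' : LinkGaussDiagram} (m : Movie L L'),
    m.deathCount = 0 → ∀ (c : Fin (2 * L.n) → Bool) (t : Bool) (u : Fin L.free → Bool)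
      (u' : Fin L'.free → Bool), m.coeff c t u u' = if m.pull u' = u then m.weightB c t u' else 0
  | _, _, .nil _, _, _, _, _, _ => by simp only [Movie.coeff, Movie.pull, Movie.weightB]
  | _, _, .cons s m, h, c, t, u, u' => by
    classical
    have hs : s.deathCount = 0 := by unfold Movie.deathCount at h; omega
    have hm : m.deathCount = 0 := by unfold Movie.deathCount at h; omega
    simp only [Movie.coeff, Movie.pull, Movie.weightB, s.coeff_eq_of_deathCount hs,
      m.coeff_eq_of_deathCount hm, mul_ite, mul_zero]
    rw [Finset.sum_ite_eq Finset.univ (m.pull u'), if_pos (Finset.mem_univ _)]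
    split_ifs <;> ring

/-- **Prop. 4.1 for a movie without births: diagonal tracking with a nonzero constant.** The
canonical generator `𝔰_{t,u}` goes to `weightF • 𝔰'_{t, push u}`, ONE canonical generator of
the final frame with a nonzero constant (`weightF_ne_zero`) — the shape of Cor. 4.2 for the
half of a ribbon-type movie without index-`0` points. [cite: Rasmussen2010, Cor. 4.2] -/
theorem Movie.map_leeMonomial_leeState_of_birthCount (m : Movie L L') (h : m.birthCount = 0)
    {c : Fin (2 * L.n) → Bool} (hc : L.IsCheckerboard c) (hm : m.Coherent c) (t : Bool)
    (u : Fin L.free → Bool) :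
    m.map 0 (L.leeMonomial 0 (L.leeState hc t u)) =
      m.weightF c t u • L'.leeMonomial 0 (L'.leeState (hc.movie m hm) t (m.push u)) := by
  classical
  rw [m.map_leeMonomial_leeState hc hm t u]
  simp_rw [m.coeff_eq_of_birthCount h c t u]
  exact sum_ite_eq_smul (m.push u) _ _

/-- **Nonvanishing without births.** [cite: Rasmussen2010, Cor. 4.2] -/
theorem Movie.map_leeMonomial_leeState_ne_zero_of_birthCount (m : Movie L L')
    (h : m.birthCount = 0) {c : Fin (2 * L.n) → Bool} (hc : L.IsCheckerboard c)
    (hm : m.Coherent c) (t : Bool) (u : Fin L.free → Bool) :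
    m.map 0 (L.leeMonomial 0 (L.leeState hc t u)) ≠ 0 := by
  rw [m.map_leeMonomial_leeState_of_birthCount h hc hm t u]
  exact smul_ne_zero (m.weightF_ne_zero c t u) (leeMonomial_leeState_ne_zero _ t _)

/-- **Nonvanishing without deaths**: every branch survives with a nonzero coefficient, and
some final labelling pulls back to `u`. [cite: Rasmussen2010, Cor. 4.2] -/
theorem Movie.map_leeMonomial_leeState_ne_zero_of_deathCount (m : Movie L L')
    (h : m.deathCount = 0) {c : Fin (2 * L.n) → Bool} (hc : L.IsCheckerboard c)
    (hm : m.Coherent c) (t : Bool) (u : Fin L.free → Bool) :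
    m.map 0 (L.leeMonomial 0 (L.leeState hc t u)) ≠ 0 := by
  rw [m.map_leeMonomial_leeState_ne_zero_iff hc hm t u]
  obtain ⟨u', hu'⟩ := m.pull_surjective h u
  exact ⟨u', by rw [m.coeff_eq_of_deathCount h, if_pos hu']; exact m.weightB_ne_zero c t u'⟩

/-! ## What a movie of this layer cannot reach -/

/-- **No movie of this layer connects diagrams with different numbers of chords**
(`Movie.n_eq`). [folklore] -/
theorem isEmpty_movie_of_n_ne (h : L'.n ≠ L.n) : IsEmpty (Movie L L') :=
  ⟨fun m ↦ h m.n_eq⟩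

/-- In particular there is no movie of births, deaths, saddles and relabellings from the image
of a knot diagram with a crossing to the crossingless unknot `unknots 1`: the movie of a slice
disc needs the Reidemeister steps of the next layer, whose maps compose with the present ones
through `IsFilteredLeeMap.comp` and feed the adapters below. [folklore] -/
theorem isEmpty_movie_ofGaussDiagram_unknots {G : GaussDiagram} (hG : G.n ≠ 0) (k : ℕ) :
    IsEmpty (Movie (ofGaussDiagram G) (unknots k)) :=
  isEmpty_movie_of_n_ne fun h ↦ hG h.symm

/-! ## Adapters: from the link tower's shape to the consumer's hypotheses -/

section Adapters

variable (G : GaussDiagram) (hG : G.n ≠ 0)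

/-- Quantum degrees of the relabelled basis elements correspond. [cite: BarNatan2002, §3.2] -/
theorem qDegree_degStatesEquiv (i : ℤ) (s : (ofGaussDiagram G).degStates i) :
    GaussDiagram.qDegree (degStatesEquiv G hG i s).1 = qDegree s.1 :=
  qDegree_enhancedStateEquiv G hG s.1

/-- **The relabelling of bases `funCongrLeft (degStatesEquiv)` preserves the filtration
degree** (supports and quantum degrees correspond). [cite: Rasmussen2010, §2] -/
theorem qMin_funCongrLeft (x : G.degStates 0 → ℚ) :
    qMin (LinearEquiv.funCongrLeft ℚ ℚ (degStatesEquiv G hG 0) x) = GaussDiagram.qMin x := by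
  unfold qMin GaussDiagram.qMin
  refine Equiv.iInf_congr (degStatesEquiv G hG 0) fun s ↦ ?_
  simp only [Set.mem_setOf_eq, LinearEquiv.funCongrLeft_apply, LinearMap.funLeft_apply,
    qDegree_degStatesEquiv]

/-- The inverse relabelling preserves the filtration degree. [cite: Rasmussen2010, §2] -/
theorem qMin_funCongrLeft_symm (y : (ofGaussDiagram G).degStates 0 → ℚ) :
    GaussDiagram.qMin ((LinearEquiv.funCongrLeft ℚ ℚ (degStatesEquiv G hG 0)).symm y) = qMin y := by
  rw [← qMin_funCongrLeft G hG, LinearEquiv.apply_symm_apply]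

variable {G}

/-- **Forward adapter.** Let `G` be a knot Gauss diagram with a chord and Gauss parity, and
`F : C⁰(ofGaussDiagram G) → C⁰(unknots 1)` a linear map of degree-zero Lee chains of the LINK
tower sending boundaries to boundaries, not decreasing `qMin`, and sending the two canonical
generators `𝔰_t = leeMonomial 0 (leeState _ t Fin.elim0)` (`t : Bool`) to nonzero multiples,
modulo boundaries, of the Lee monomials of two DISTINCT enhanced states `e t` of `unknots 1`
(the output of Prop. 4.1 / Cor. 4.2 for a movie `ofGaussDiagram G → ⋯ → unknots 1`). Then
`F ∘ funCongrLeft (degStatesEquiv G hG 0)` satisfies LITERALLY the `F`-hypotheses of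
`eq_zero_of_isSmoothlySlice_of_canonical_unknotOne` for `G` (`khovanovD_comp_funCongrLeft`,
`qMin_funCongrLeft`, `funCongrLeft_leeCoord_symm_single_leeState`, `noFreeEquivBool`).
[cite: Rasmussen2010, Cor. 4.2] -/
theorem exists_canonical_of_ofGaussDiagram (hG : G.n ≠ 0)
    (hpar : ∀ i, (G.overPos i).val % 2 ≠ (G.underPos i).val % 2)
    (F : ((ofGaussDiagram G).degStates 0 → ℚ) →ₗ[ℚ] ((unknots 1).degStates 0 → ℚ))
    (hFA : ∀ x ∈ LinearMap.range ((ofGaussDiagram G).khovanovD ℚ 0 1 (0 - 1) 0),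
      F x ∈ LinearMap.range ((unknots 1).khovanovD ℚ 0 1 (0 - 1) 0))
    (hFq : ∀ x, qMin x ≤ qMin (F x))
    (e : Bool → (unknots 1).EnhancedState) (he : Injective e)
    (htrack : ∀ t, ∃ a : ℚ, a ≠ 0 ∧
      F ((ofGaussDiagram G).leeMonomial 0 ((ofGaussDiagram G).leeState
        (isCheckerboard_ofGaussDiagram G hpar) t Fin.elim0)) - a • (unknots 1).leeMonomial 0 (e t) ∈
        LinearMap.range ((unknots 1).khovanovD ℚ 0 1 (0 - 1) 0)) :
    ∃ F' : (G.degStates 0 → ℚ) →ₗ[ℚ] ((unknots 1).degStates 0 → ℚ),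
      (∀ y, F' (G.khovanovD ℚ 0 1 (0 - 1) 0 y) ∈
        LinearMap.range ((unknots 1).khovanovD ℚ 0 1 (0 - 1) 0)) ∧
      (∀ x, GaussDiagram.qMin x ≤ qMin (F' x)) ∧
      ∃ e' : {s : G.degStates 0 // ∀ i, ¬ G.Free s.1.label i} → (unknots 1).EnhancedState,
        Injective e' ∧ ∀ s, ∃ a : ℚ, a ≠ 0 ∧
          F' ((G.leeCoord 0).symm (Pi.single s.1 1)) - a • (unknots 1).leeMonomial 0 (e' s) ∈
            LinearMap.range ((unknots 1).khovanovD ℚ 0 1 (0 - 1) 0) := by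
  refine ⟨F ∘ₗ (LinearEquiv.funCongrLeft ℚ ℚ (degStatesEquiv G hG 0)).toLinearMap, fun y ↦ ?_,
    fun x ↦ ?_, fun s ↦ e (G.noFreeEquivBool hpar s),
    he.comp (G.noFreeEquivBool hpar).injective, fun s ↦ ?_⟩
  · refine hFA _ ⟨LinearEquiv.funCongrLeft ℚ ℚ (degStatesEquiv G hG (0 - 1)) y, ?_⟩
    exact LinearMap.congr_fun (khovanovD_comp_funCongrLeft G hG ℚ 0 1 (0 - 1) 0) y
  · rw [LinearMap.comp_apply, LinearEquiv.coe_coe, ← qMin_funCongrLeft G hG x]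
    exact hFq _
  · obtain ⟨t, rfl⟩ := (G.noFreeEquivBool hpar).symm.surjective s
    obtain ⟨a, ha, hmem⟩ := htrack t
    have h2 : ((2 : ℚ) ^ G.circleCount G.seifertState) ≠ 0 := pow_ne_zero _ two_ne_zero
    refine ⟨((2 : ℚ) ^ G.circleCount G.seifertState)⁻¹ * a, mul_ne_zero (inv_ne_zero h2) ha, ?_⟩
    simp only [Equiv.apply_symm_apply, LinearMap.comp_apply, LinearEquiv.coe_coe]
    show F (LinearEquiv.funCongrLeft ℚ ℚ (degStatesEquiv G hG 0) ((G.leeCoord 0).symm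
      (Pi.single ⟨G.leeState hpar t, GaussDiagram.homDegree_leeState hpar t⟩ 1))) -
      (((2 : ℚ) ^ G.circleCount G.seifertState)⁻¹ * a) • (unknots 1).leeMonomial 0 (e t) ∈
      LinearMap.range ((unknots 1).khovanovD ℚ 0 1 (0 - 1) 0)
    have key : LinearEquiv.funCongrLeft ℚ ℚ (degStatesEquiv G hG 0) ((G.leeCoord 0).symm
        (Pi.single ⟨G.leeState hpar t, GaussDiagram.homDegree_leeState hpar t⟩ 1)) =
        ((2 : ℚ) ^ G.circleCount G.seifertState)⁻¹ • (ofGaussDiagram G).leeMonomial 0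
          ((ofGaussDiagram G).leeState (isCheckerboard_ofGaussDiagram G hpar) t Fin.elim0) := by
      rw [← funCongrLeft_leeCoord_symm_single_leeState G hG hpar t, map_smul, smul_smul,
        inv_mul_cancel₀ h2, one_smul]
    rw [key, map_smul, mul_smul, ← smul_sub]
    exact Submodule.smul_mem _ _ hmem

/-- **Backward adapter.** Let `Ψ : C⁰(unknots 1) → C⁰(ofGaussDiagram G)` be a linear map of
degree-zero Lee chains of the LINK tower sending cycles to cycles, not decreasing `qMin`, and
sending the Lee monomial of each enhanced state `S` of `unknots 1` to a nonzero multiple,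
modulo boundaries, of the canonical generator `𝔰_{e S}` with `e` injective (Prop. 4.1 /
Cor. 4.2 for a movie `unknots 1 → ⋯ → ofGaussDiagram G`). Then
`funCongrLeft (degStatesEquiv G hG 0)⁻¹ ∘ Ψ` satisfies LITERALLY the `Ψ`-hypotheses of
`eq_zero_of_isSmoothlySlice_of_canonical_unknotOne` for `G`. [cite: Rasmussen2010, Cor. 4.2] -/
theorem exists_canonical_of_ofGaussDiagram_symm (hG : G.n ≠ 0)
    (hpar : ∀ i, (G.overPos i).val % 2 ≠ (G.underPos i).val % 2)
    (Ψ : ((unknots 1).degStates 0 → ℚ) →ₗ[ℚ] ((ofGaussDiagram G).degStates 0 → ℚ))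
    (hΨB : ∀ w ∈ (unknots 1).leeCycles, Ψ w ∈ (ofGaussDiagram G).leeCycles)
    (hΨq : ∀ x, qMin x ≤ qMin (Ψ x))
    (e : (unknots 1).EnhancedState → Bool) (he : Injective e)
    (htrack : ∀ S, ∃ a : ℚ, a ≠ 0 ∧
      Ψ ((unknots 1).leeMonomial 0 S) - a • (ofGaussDiagram G).leeMonomial 0
        ((ofGaussDiagram G).leeState (isCheckerboard_ofGaussDiagram G hpar) (e S) Fin.elim0) ∈
        LinearMap.range ((ofGaussDiagram G).khovanovD ℚ 0 1 (0 - 1) 0)) :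
    ∃ Ψ' : ((unknots 1).degStates 0 → ℚ) →ₗ[ℚ] (G.degStates 0 → ℚ),
      (∀ w ∈ (unknots 1).leeCycles, Ψ' w ∈ G.leeCycles) ∧
      (∀ x, qMin x ≤ GaussDiagram.qMin (Ψ' x)) ∧
      ∃ e' : (unknots 1).EnhancedState → {s : G.degStates 0 // ∀ i, ¬ G.Free s.1.label i},
        Injective e' ∧ ∀ S, ∃ a : ℚ, a ≠ 0 ∧
          Ψ' ((unknots 1).leeMonomial 0 S) - a • (G.leeCoord 0).symm (Pi.single (e' S).1 1) ∈
            LinearMap.range (G.khovanovD ℚ 0 1 (0 - 1) 0) := by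
  set φ₀ := LinearEquiv.funCongrLeft ℚ ℚ (degStatesEquiv G hG 0) with hφ₀
  have hd₀ := symm_comp_eq_comp_symm φ₀ (LinearEquiv.funCongrLeft ℚ ℚ (degStatesEquiv G hG (0 + 1)))
    (G.khovanovD ℚ 0 1 0 (0 + 1)) ((ofGaussDiagram G).khovanovD ℚ 0 1 0 (0 + 1))
    (khovanovD_comp_funCongrLeft G hG ℚ 0 1 0 (0 + 1)).symm
  have hdm := symm_comp_eq_comp_symm (LinearEquiv.funCongrLeft ℚ ℚ (degStatesEquiv G hG (0 - 1)))
    φ₀ (G.khovanovD ℚ 0 1 (0 - 1) 0) ((ofGaussDiagram G).khovanovD ℚ 0 1 (0 - 1) 0)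
    (khovanovD_comp_funCongrLeft G hG ℚ 0 1 (0 - 1) 0).symm
  refine ⟨φ₀.symm.toLinearMap ∘ₗ Ψ, fun w hw ↦ ?_, fun x ↦ ?_,
    fun S ↦ (G.noFreeEquivBool hpar).symm (e S),
    (G.noFreeEquivBool hpar).symm.injective.comp he, fun S ↦ ?_⟩
  · have hz := hΨB w hw
    rw [LinearMap.mem_ker] at hz ⊢
    have h := LinearMap.congr_fun hd₀ (Ψ w)
    simp only [LinearMap.coe_comp, Function.comp_apply, LinearEquiv.coe_coe, hz, map_zero] at h
    rw [LinearMap.comp_apply, LinearEquiv.coe_coe]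
    exact h.symm
  · rw [LinearMap.comp_apply, LinearEquiv.coe_coe, hφ₀, qMin_funCongrLeft_symm G hG]
    exact hΨq x
  · obtain ⟨a, ha, w, hw⟩ := htrack S
    have h2 : ((2 : ℚ) ^ G.circleCount G.seifertState) ≠ 0 := pow_ne_zero _ two_ne_zero
    refine ⟨a * (2 : ℚ) ^ G.circleCount G.seifertState, mul_ne_zero ha h2,
      (LinearEquiv.funCongrLeft ℚ ℚ (degStatesEquiv G hG (0 - 1))).symm w, ?_⟩
    have key : φ₀.symm ((ofGaussDiagram G).leeMonomial 0 ((ofGaussDiagram G).leeState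
        (isCheckerboard_ofGaussDiagram G hpar) (e S) Fin.elim0)) =
        (2 : ℚ) ^ G.circleCount G.seifertState • (G.leeCoord 0).symm
          (Pi.single ⟨G.leeState hpar (e S), GaussDiagram.homDegree_leeState hpar (e S)⟩ 1) := by
      rw [LinearEquiv.symm_apply_eq, hφ₀, funCongrLeft_leeCoord_symm_single_leeState G hG hpar]
    show G.khovanovD ℚ 0 1 (0 - 1) 0 _ = φ₀.symm (Ψ ((unknots 1).leeMonomial 0 S)) -
      (a * (2 : ℚ) ^ G.circleCount G.seifertState) • (G.leeCoord 0).symm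
        (Pi.single ⟨G.leeState hpar (e S), GaussDiagram.homDegree_leeState hpar (e S)⟩ 1)
    have h := LinearMap.congr_fun hdm w
    simp only [LinearMap.coe_comp, Function.comp_apply, LinearEquiv.coe_coe] at h
    rw [← h, hw, map_sub, map_smul, key, smul_smul]

end Adapters

/-! ## The package for a regular projection -/

/-- **The crossingless case `G.n = 0`.** A knot Gauss diagram without chord IS
`GaussDiagram.empty` (`eq_empty_of_n_eq_zero`), the knot tower's crossingless unknot, and the
comparison equivalence `leeChainUnknotOneEquiv 0 : C⁰(unknots 1) ≃ C⁰(GaussDiagram.empty)` of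
`LinkKhUnknotOne` and its inverse already satisfy the consumer's conjunction (identity
cobordism): boundaries vanish (`khovanovD_empty`), `qMin` is preserved, and the canonical
generators correspond with the constants `1/2` and `2`
(`leeChainUnknotOneEquiv_symm_leeCoord_symm_single`, `leeChainUnknotOneEquiv_leeMonomial`).
[cite: Rasmussen2010, §3] -/
theorem canonical_hypotheses_of_n_eq_zero (G : GaussDiagram) (hG : G.n = 0) :
    (∃ F : (G.degStates 0 → ℚ) →ₗ[ℚ] ((unknots 1).degStates 0 → ℚ),
        (∀ y, F (G.khovanovD ℚ 0 1 (0 - 1) 0 y) ∈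
          LinearMap.range ((unknots 1).khovanovD ℚ 0 1 (0 - 1) 0)) ∧
        (∀ x, GaussDiagram.qMin x ≤ qMin (F x)) ∧
        ∃ e : {s : G.degStates 0 // ∀ i, ¬ G.Free s.1.label i} → (unknots 1).EnhancedState,
          Injective e ∧ ∀ s, ∃ c : ℚ, c ≠ 0 ∧
            F ((G.leeCoord 0).symm (Pi.single s.1 1)) - c • (unknots 1).leeMonomial 0 (e s) ∈
              LinearMap.range ((unknots 1).khovanovD ℚ 0 1 (0 - 1) 0)) ∧
      (∃ Ψ : ((unknots 1).degStates 0 → ℚ) →ₗ[ℚ] (G.degStates 0 → ℚ),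
        (∀ w ∈ (unknots 1).leeCycles, Ψ w ∈ G.leeCycles) ∧
        (∀ x, qMin x ≤ GaussDiagram.qMin (Ψ x)) ∧
        ∃ e : (unknots 1).EnhancedState → {s : G.degStates 0 // ∀ i, ¬ G.Free s.1.label i},
          Injective e ∧ ∀ S, ∃ c : ℚ, c ≠ 0 ∧
            Ψ ((unknots 1).leeMonomial 0 S) - c • (G.leeCoord 0).symm (Pi.single (e S).1 1) ∈
              LinearMap.range (G.khovanovD ℚ 0 1 (0 - 1) 0)) := by
  obtain rfl := GaussDiagram.eq_empty_of_n_eq_zero hG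
  refine ⟨⟨(leeChainUnknotOneEquiv 0).symm.toLinearMap, fun y ↦ ?_, fun x ↦ ?_,
      fun s ↦ enhancedStateUnknotOneEquiv.symm s.1.1, fun s s' h ↦ ?_,
      fun s ↦ ⟨1 / 2, by norm_num, ?_⟩⟩,
    ⟨(leeChainUnknotOneEquiv 0).toLinearMap, fun w _ ↦ ?_, fun x ↦ ?_,
      fun S ↦ ⟨⟨enhancedStateUnknotOneEquiv S, GaussDiagram.homDegree_empty _⟩,
        GaussDiagram.not_free_empty _⟩, fun S S' h ↦ ?_, fun S ↦ ⟨2, two_ne_zero, ?_⟩⟩⟩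
  · rw [GaussDiagram.khovanovD_empty, LinearMap.zero_apply, map_zero]
    exact Submodule.zero_mem _
  · exact (qMin_leeChainUnknotOneEquiv_symm x).ge
  · exact Subtype.ext (Subtype.ext (enhancedStateUnknotOneEquiv.symm.injective h))
  · rw [LinearEquiv.coe_coe, leeChainUnknotOneEquiv_symm_leeCoord_symm_single, sub_self]
    exact Submodule.zero_mem _
  · rw [GaussDiagram.leeCycles_empty]
    exact Submodule.mem_top
  · exact (qMin_leeChainUnknotOneEquiv x).ge
  · exact enhancedStateUnknotOneEquiv.injective
      (congrArg Subtype.val (congrArg Subtype.val h) :)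
  · rw [LinearEquiv.coe_coe, leeChainUnknotOneEquiv_leeMonomial, sub_self]
    exact Submodule.zero_mem _

/-- **The hypotheses of `eq_zero_of_isSmoothlySlice_of_canonical_unknotOne` from link-tower
data.** For a regular projection `P` of a knot with a crossing (`P.diagram.n ≠ 0`; Gauss parity
holds by `RegularProjection.overPos_mod_two_ne_underPos_mod_two`), linear maps of degree-zero
Lee chains `F : C⁰(ofGaussDiagram P.diagram) → C⁰(unknots 1)` (boundaries ↦ boundaries,
`qMin` non-decreasing — e.g. `Movie.Coherent.isFilteredLeeMap` with `degShift = 0` — and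
tracking the two canonical generators `𝔰_t` onto an injective pair of enhanced states of
`unknots 1` with nonzero constants modulo boundaries) and
`Ψ : C⁰(unknots 1) → C⁰(ofGaussDiagram P.diagram)` (cycles ↦ cycles, `qMin` non-decreasing,
tracking the two Lee monomials of `unknots 1` onto `𝔰_{e' S}` with `e'` injective) yield
LITERALLY the conjunction assumed for `P` by `eq_zero_of_isSmoothlySlice_of_canonical_unknotOne`.
Rasmussen (2010), Prop. 4.1, Cor. 4.2, §4.4. [cite: Rasmussen2010, Cor. 4.2] -/
theorem canonical_hypotheses_of_linkMaps {K : Knot} (P : K.RegularProjection) (hn : P.diagram.n ≠ 0)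
    (F : ((ofGaussDiagram P.diagram).degStates 0 → ℚ) →ₗ[ℚ] ((unknots 1).degStates 0 → ℚ))
    (hFA : ∀ x ∈ LinearMap.range ((ofGaussDiagram P.diagram).khovanovD ℚ 0 1 (0 - 1) 0),
      F x ∈ LinearMap.range ((unknots 1).khovanovD ℚ 0 1 (0 - 1) 0))
    (hFq : ∀ x, qMin x ≤ qMin (F x))
    (e : Bool → (unknots 1).EnhancedState) (he : Injective e)
    (htrack : ∀ t, ∃ a : ℚ, a ≠ 0 ∧
      F ((ofGaussDiagram P.diagram).leeMonomial 0 ((ofGaussDiagram P.diagram).leeState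
        (isCheckerboard_ofGaussDiagram P.diagram P.overPos_mod_two_ne_underPos_mod_two) t
        Fin.elim0)) - a • (unknots 1).leeMonomial 0 (e t) ∈
        LinearMap.range ((unknots 1).khovanovD ℚ 0 1 (0 - 1) 0))
    (Ψ : ((unknots 1).degStates 0 → ℚ) →ₗ[ℚ] ((ofGaussDiagram P.diagram).degStates 0 → ℚ))
    (hΨB : ∀ w ∈ (unknots 1).leeCycles, Ψ w ∈ (ofGaussDiagram P.diagram).leeCycles)
    (hΨq : ∀ x, qMin x ≤ qMin (Ψ x))
    (e' : (unknots 1).EnhancedState → Bool) (he' : Injective e')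
    (htrack' : ∀ S, ∃ a : ℚ, a ≠ 0 ∧
      Ψ ((unknots 1).leeMonomial 0 S) - a • (ofGaussDiagram P.diagram).leeMonomial 0
        ((ofGaussDiagram P.diagram).leeState
          (isCheckerboard_ofGaussDiagram P.diagram P.overPos_mod_two_ne_underPos_mod_two) (e' S)
          Fin.elim0) ∈
        LinearMap.range ((ofGaussDiagram P.diagram).khovanovD ℚ 0 1 (0 - 1) 0)) :
    (∃ F : (P.diagram.degStates 0 → ℚ) →ₗ[ℚ] ((unknots 1).degStates 0 → ℚ),
        (∀ y, F (P.diagram.khovanovD ℚ 0 1 (0 - 1) 0 y) ∈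
          LinearMap.range ((unknots 1).khovanovD ℚ 0 1 (0 - 1) 0)) ∧
        (∀ x, GaussDiagram.qMin x ≤ qMin (F x)) ∧
        ∃ e : {s : P.diagram.degStates 0 // ∀ i, ¬ P.diagram.Free s.1.label i} →
            (unknots 1).EnhancedState,
          Injective e ∧ ∀ s, ∃ c : ℚ, c ≠ 0 ∧
            F ((P.diagram.leeCoord 0).symm (Pi.single s.1 1)) -
                c • (unknots 1).leeMonomial 0 (e s) ∈
              LinearMap.range ((unknots 1).khovanovD ℚ 0 1 (0 - 1) 0)) ∧
      (∃ Ψ : ((unknots 1).degStates 0 → ℚ) →ₗ[ℚ] (P.diagram.degStates 0 → ℚ),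
        (∀ w ∈ (unknots 1).leeCycles, Ψ w ∈ P.diagram.leeCycles) ∧
        (∀ x, qMin x ≤ GaussDiagram.qMin (Ψ x)) ∧
        ∃ e : (unknots 1).EnhancedState →
            {s : P.diagram.degStates 0 // ∀ i, ¬ P.diagram.Free s.1.label i},
          Injective e ∧ ∀ S, ∃ c : ℚ, c ≠ 0 ∧
            Ψ ((unknots 1).leeMonomial 0 S) -
                c • (P.diagram.leeCoord 0).symm (Pi.single (e S).1 1) ∈
              LinearMap.range (P.diagram.khovanovD ℚ 0 1 (0 - 1) 0)) :=
  ⟨exists_canonical_of_ofGaussDiagram hn P.overPos_mod_two_ne_underPos_mod_two F hFA hFq e he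
      htrack,
    exists_canonical_of_ofGaussDiagram_symm hn P.overPos_mod_two_ne_underPos_mod_two Ψ hΨB hΨq e'
      he' htrack'⟩

end LinkGaussDiagram

/-! ## The named fact from link-tower data -/

open LinkGaussDiagram in
/-- **Rasmussen's Theorem 1 (slice case) from link-tower movie data.** Suppose that every
regular projection `P` WITH A CROSSING of every smoothly slice knot comes with linear maps of
degree-zero Lee chains of the link tower
`F : C⁰(ofGaussDiagram P.diagram) → C⁰(unknots 1)` (boundaries ↦ boundaries, `qMin`
non-decreasing, tracking the two canonical generators `𝔰_t` onto an injective pair of enhanced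
states of `unknots 1` with nonzero constants modulo boundaries) and
`Ψ : C⁰(unknots 1) → C⁰(ofGaussDiagram P.diagram)` (cycles ↦ cycles, `qMin` non-decreasing,
tracking the Lee monomials of `unknots 1` onto `𝔰_{e' S}`, `e'` injective) — the output of a
movie of the slice disc read in the link tower (Rasmussen (2010), §4.1–4.3, Prop. 4.1, Cor. 4.2;
the filtration and chain parts are `IsFilteredLeeMap` of T7a). Then the named fact
`eq_zero_of_isSmoothlySlice` holds (`canonical_hypotheses_of_linkMaps` for `n ≠ 0`,
`canonical_hypotheses_of_n_eq_zero` for the crossingless projections, fed to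
`eq_zero_of_isSmoothlySlice_of_canonical_unknotOne`). [cite: Rasmussen2010, Thm. 1] -/
theorem eq_zero_of_isSmoothlySlice_of_linkMaps
    (h : ∀ {K : Knot} (P : K.RegularProjection), K.IsSmoothlySlice → P.diagram.n ≠ 0 →
      (∃ F : ((ofGaussDiagram P.diagram).degStates 0 → ℚ) →ₗ[ℚ] ((unknots 1).degStates 0 → ℚ),
        (∀ x ∈ LinearMap.range ((ofGaussDiagram P.diagram).khovanovD ℚ 0 1 (0 - 1) 0),
          F x ∈ LinearMap.range ((unknots 1).khovanovD ℚ 0 1 (0 - 1) 0)) ∧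
        (∀ x, qMin x ≤ qMin (F x)) ∧
        ∃ e : Bool → (unknots 1).EnhancedState, Injective e ∧ ∀ t, ∃ a : ℚ, a ≠ 0 ∧
          F ((ofGaussDiagram P.diagram).leeMonomial 0 ((ofGaussDiagram P.diagram).leeState
            (isCheckerboard_ofGaussDiagram P.diagram P.overPos_mod_two_ne_underPos_mod_two) t
            Fin.elim0)) - a • (unknots 1).leeMonomial 0 (e t) ∈
            LinearMap.range ((unknots 1).khovanovD ℚ 0 1 (0 - 1) 0)) ∧
      (∃ Ψ : ((unknots 1).degStates 0 → ℚ) →ₗ[ℚ] ((ofGaussDiagram P.diagram).degStates 0 → ℚ),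
        (∀ w ∈ (unknots 1).leeCycles, Ψ w ∈ (ofGaussDiagram P.diagram).leeCycles) ∧
        (∀ x, qMin x ≤ qMin (Ψ x)) ∧
        ∃ e' : (unknots 1).EnhancedState → Bool, Injective e' ∧ ∀ S, ∃ a : ℚ, a ≠ 0 ∧
          Ψ ((unknots 1).leeMonomial 0 S) - a • (ofGaussDiagram P.diagram).leeMonomial 0
            ((ofGaussDiagram P.diagram).leeState
              (isCheckerboard_ofGaussDiagram P.diagram P.overPos_mod_two_ne_underPos_mod_two)
              (e' S) Fin.elim0) ∈
            LinearMap.range ((ofGaussDiagram P.diagram).khovanovD ℚ 0 1 (0 - 1) 0))) :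
    eq_zero_of_isSmoothlySlice :=
  eq_zero_of_isSmoothlySlice_of_canonical_unknotOne fun P hs ↦ by
    by_cases hn : P.diagram.n = 0
    · exact canonical_hypotheses_of_n_eq_zero P.diagram hn
    · obtain ⟨⟨F, hFA, hFq, e, he, htrack⟩, ⟨Ψ, hΨB, hΨq, e', he', htrack'⟩⟩ := h P hs hn
      exact canonical_hypotheses_of_linkMaps P hn F hFA hFq e he htrack Ψ hΨB hΨq e' he' htrack'

end Literature.Topology.FourManifolds

end
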